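import Literature.MathematicalPhysics.QuantumFieldTheory.Balaban1983to89.B7Eq106Concrete

/-!
# B7 Sect. F, opening (pp. 43–44): the regularity condition (165), the class `Λ_k(U₀, α₃)` (166)–(167), and the
flat-background certificate that the gauge fixing (104)–(106) belongs to `Λ_k(1, 72d·α₁)` (`B7Eq167Flat`)

Source: T. Bałaban, *Averaging operations for lattice gauge theories*, Commun. Math. Phys. **98** (1985) 17–51
[cite: Balaban1985Averaging], Sect. F pp. 43–44, formulas (165)–(167), with (107)–(108) p. 33 (`B7Eq106Concrete`) and
Prop. 4 at `V₀ = 1` ((131) p. 38 = (161) p. 42, `B7Prop4Flat`) as the inputs. Page numbers are journal pages; every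
quotation below was read on the page renders (journal page = render page + 16).

## What this file is

Sect. F opens (p. 43): "In the last section of the paper we will study the averaging operations for gauge
transformations, given by (61), (78)–(80). A natural analog of the regularity condition (52) would be the condition
|(∂_{U₀}u)(b)| = |R(U_{0,b})u(b₊) − u(b₋)| < α₀η, b ⊂ Ω. (165) We will consider functions u satisfying this condition,
but we have to consider also the functions u given by the formulas (104)–(106). They appear naturally in our
considerations and generally they do not satisfy the regularity condition (165), but they satisfy other conditions
following from (107), (108) if the configuration U₁ is small, i.e., |U₁ − 1| < α₁η, α₁ small. We define:" and p. 44: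
"Λ_k(U₀, α₃) is a set of gauge transformations u defined on Ω, and satisfying the conditions
|(\overline{R₀u^j})(x_j) − 1| < α₃, x_j ∈ Ω^{(j)}, j = 0, 1, …, k, (166)
|(\overline{R₀u^j})⁻¹(x_{j+1})(R̄^j_{0,x_{j+1}}\overline{R₀u^j})(x_j) − 1| < α₃L^{j+1}η, x_{j+1} ∈ Ω^{(j+1)}, x_j ∈ B(x_{j+1}),
j = 0, 1, …, k − 1. (167) From this it is obvious that for u ∈ Λ_k(U₀, α₃) and α₃ small, all operations needed to define
\overline{R₀u^k} are done always in a case where proper expressions are small. More exactly, we have to calculate a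
logarithm of the expression in (167) and this expression is small." (Print's overline spans `R₀u^j`; it is the `j`-th
order average `\overline{R₀u}^j` of (79)–(80) p. 30, `B7Eq84Concrete.uavg … j`.)

This file TYPES (165), (166), (167) and the class `Λ_k(U₀, α₃)` over the concrete objects of the Sect. C leaves
(`Reg165`, `Cond166`, `Cond167`, `InLambda`, §1), records the two structural remarks of the quoted paragraph (§2:
the expression of (167) IS `(R̄^j_{0,x_{j+1}}U̿^j_1)(Γ_{x_{j+1},x_j})` for a solution of the axial gauge conditions (67), by
(108) — `cond167_iff_dbavgCovIter`; and the averaging step (80) takes the logarithm of exactly the expression of (167) —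
`val_uavg_succ`), and CERTIFIES the sentence "they satisfy other conditions following from (107), (108) if the
configuration U₁ is small" QUANTITATIVELY AT THE FLAT BACKGROUND `U₀ = 1` (§5), the regime in which Props 3 and 4 are in
the tree (`B7Prop3Flat.frame_estimate`, `B7Prop4Flat.prop4_flat_induction`): for `U₁ = e^{B}` bondwise with `|B| ≤ b`,
`L ≥ 2`, `8C₁(d)·L^k b ≤ 1` and `128d·L^k b ≤ 1`, EVERY solution `u` of (67) + (81) — in particular the gauge fixing
(104)–(106), `B7Eq84Concrete.glev` — satisfies

* (167) with the right-hand side `e^{θ_j} − 1 ≤ 4d·L^{j+1} b`, `θ_j := 2d·L^{j+1} b` (`cond167_flat`): by (108) the expression is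
  the transport `U̿^j(Γ_{x_{j+1},x_j})` of the `j`-fold double average along a block tree contour of length `≤ dL`, and
  Prop. 4 gives `|log U̿^j| ≤ 2L^j b` ((161)); print's factor `L^{j+1}η` is this growth `L^j` times the contour scale `L`
  (with `b = α₁η`);
* (166) with the right-hand side `e^{36d·L^k b} − 1 ≤ 72d·L^k b` (`cond166_flat`): by (107) (`B7Eq106Concrete.eq107`, at
  `U₀ = 1` all background rotations are trivial, `eq107_one_left`) `(\overline{R₀u}^j)(x_j)` is the descending product over
  the levels `m = k − 1, …, j` of the factors `(\overline{U̿^m})(x_{m+1})⁻¹·U̿^m(Γ_{x_{m+1},x_m})`, each within `e^{9θ_m} − 1` of `1`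
  (frame `(\overline{U̿^m})^{−1}`: `8θ_m` by (111)–(112), `B7Prop3Flat.frame_estimate`; transport: `e^{θ_m} − 1`), and
  `Σ_{m=j}^{k−1} 9θ_m ≤ 36d·L^k b` (geometric sum, `L ≥ 2`);

hence `u ∈ Λ_k(1, α₃)` with `α₃ = 72d·L^k b`, `η = L^{−k}` (`inLambda_flat`, `inLambda_glev_flat`), i.e. in print's letters
(`b = α₁η`, `L^kη = 1`): `u ∈ Λ_k(1, 72d·α₁)` whenever `8C₁(d)α₁ ≤ 1` and `128d·α₁ ≤ 1` (`inLambda_flat_eta`) — the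
"`α₁` small" and the implicit `O(1)` of the quoted sentence made numbers (sufficient, not optimal).

## The theorems

§1 `Reg165`, `Cond166`, `Cond167`, `InLambda` (definitions); `val_uavg_succ` ((80) unfolded by (78): the logarithm is
taken of the (167) expression); `uavg_one_right`, `inLambda_one` (`1 ∈ Λ_k(U₀, α₃)`); `reg165_one_left_iff`;
`InLambda.mono`. §2 `cond167_iff_dbavgCovIter` ((167) ⇔ a bound on the twisted transports of `U̿₁^j`, under (67), any
`U₀`), `cond167_iff_dbavgIter_one_left`, `telUp_one_left`, `lvFr_one_left`, `eq107_one_left`. §3 `norm_dprod_sub_one_le`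
(`|∏ f_i − 1| ≤ e^{Σδ_i} − 1` from `|f_i − 1| ≤ e^{δ_i} − 1`), `norm_mul_sub_one_le_exp`. §4 `exp_sub_one_le_two_mul_of_le`,
`sum_pow_succ_le`. §5 `theta` (`θ_m = 2d·L^{m+1} b`) with `theta_eq`, `theta_nonneg`, `theta_mono`, `theta_le_of_lt`;
`dbavgIter_exp_data`; `norm_hol_dbavgIter_sub_one_le` (transport); `norm_vframe_dbavgIter_sub_one_le` (frame);
`norm_levelFactor_sub_one_le`; `iterate_fl_pow_smul`; `cond166_flat`; `cond167_flat`; `inLambda_flat`; `inLambda_flat_eta`;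
`inLambda_glev_flat`.

## Readings (cell DIVERGENCE register)

(a) Print's strict `<` is typed `≤` throughout (cell convention; nothing depends on strictness).
(b) `Ω ↦ ℤ^d` per level, as in all Sect. C leaves: `x_j ∈ Ω^{(j)}` is a site `z : Site d` of the level-`j` lattice in
    level-`j` coordinates (`uavg … j` is a function on it); "`x_j ∈ B(x_{j+1})`" is `x_j = L·x_{j+1} + r`, `r ∈ [0, L)^d`
    (`boxVec L r`, (2)/(78)); the level-`j` site `z` is `(fl L)^[j] (L^j z)` (`iterate_fl_pow_smul`), so (166) is stated for ALL
    level-`j` sites.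
(c) `(R̄^j_{0,x_{j+1}}w)(x_j) = R(Ū₀^j(Γ_{x_{j+1},x_j}))w(x_j)` (p. 27, the display after (59), `B7Eq99Concrete.R0fun`) with
    `Γ_{x_{j+1},x_j}` the tree contour `treeWord (boxVec L r)` based at `L·x_{j+1}` — the contour choice of `B7Prop1Explicit`,
    the same as in (67) `AxialGauge` and (108) `eq108`.
(d) `η` is a free real parameter of `Cond167`/`InLambda` (print: `η = L^{−k}`, (4) p. 18); the flat theorems instantiate
    `η = (L^k)⁻¹`, and `inLambda_flat_eta` takes `L^kη = 1` as a hypothesis.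
(e) `|·|` is the norm of the ambient complete normed algebra `𝔸` (print: `U(N) ⊂ M_N(ℂ)`); "U₁ small, |U₁ − 1| < α₁η" is
    read in the exponential form (109) of Props 3–6, `U₁ = e^{B}` bondwise (`B7Prop3Flat.expCfg B`) with `|B| ≤ b`,
    `b ↔ α₁η` — the form in which Prop. 4 is typed (`B7Prop4Flat`); no unitarity is used or assumed.
(f) The ESTIMATES (§5) are at `U₀ = 1` only. At a curved background `U₀` satisfying (52) the same two-line argument needs
    Props 3–6 there ((111)–(112) and (161) at `U₀`), which the tree carries only as printed statements (`B7.lean`) — NOT CLAIMED here.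
    The definitions (§1) and the (108)-reading of (167) (§2) are at arbitrary `U₀`.
(g) Constants are explicit and merely sufficient: `8C₁(d)·L^k b ≤ 1` is Prop. 4's flat smallness (`B7Prop4Flat.c4`),
    `128d·L^k b ≤ 1` makes every `θ_m ≤ 1/64` (the range of `frame_estimate`) and linearises `e^{x} − 1 ≤ 2x`.

## Relation to other leaves

`B7.lean` (the abstract Sect. F: `GaugeData.InLambda` is an UNINTERPRETED field of the carrier of Props 8–10, next to the
kernel-checked recursion (171)–(173)); this leaf is the concrete class over `B7Eq84Concrete.uavg`/`avgIter` — no bridge to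
the abstract carrier is asserted (it has no semantics to match). Inputs used BY NAME: `B7Eq106Concrete.eq107`/`eq108`,
`B7Eq84Concrete.glev`/`axialGauge_glev`/`eq81_glev`, `B7Eq92Concrete` (`Rc`, `tHol`, flat specialisations),
`B7Eq99Concrete.val_R0avg`, `B7Prop4Flat.prop4_flat_induction`, `B7Prop3Flat.frame_estimate`/`vframe`/`expCfg`,
`B7Prop1Explicit.walk_linear`/`treeWord`/`l1_boxVec_le`, `B7Prop6Bound.mul_sub_one_norm_le`. Sole import:
`B7Eq106Concrete` (whose cone already contains all of these). 0 cited facts, 0 `Prop`-valued hypotheses beyond the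
displayed ones; axioms standard.

NOT CLAIMED: Props 8–10 and (168)–(206); any estimate at a curved background; that the gauge fixing violates (165)
("generally they do not satisfy the regularity condition (165)" — no counterexample is typed); optimality of `72d`.

VERSIONS: v1 (this file).
-/

noncomputable section

open NormedSpace Finset

namespace Literature.MathematicalPhysics.QuantumFieldTheory.Balaban1983to89.B7Eq167Flat

open B7Prop1Explicit B7Prop2Explicit B7Prop3Flat B7Prop4Flat MatrixLog B7AvgGaugeCovariance B7Prop6Flat
open B7Eq92Concrete B7Eq99Concrete B7Eq84Concrete B7Eq106Concrete
open B8Ineq130 (fl)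
open B8Eq115GaugeFixing (fl_smul fl_block)

export B7Prop1Explicit (Site)
export B7Eq84Concrete (AxialGauge)

variable {d : ℕ}

/-! ## §1 The conditions (165), (166), (167) and the class `Λ_k(U₀, α₃)` -/

section Defs

variable {𝔸 : Type*} [NormedRing 𝔸] [NormedAlgebra ℂ 𝔸] [CompleteSpace 𝔸]

/-- **(165)**, the regularity condition for a gauge transformation `u` relative to the background `U₀`:
"`|(∂_{U₀}u)(b)| = |R(U_{0,b})u(b₊) − u(b₋)| < α₀η, b ⊂ Ω`" — for the bond `b = ⟨x, x + e_κ⟩`, `R(U_{0,b})u(b₊) =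
U_{0,b}·u(x + e_κ)·U_{0,b}⁻¹` (56); `ε` stands for `α₀η`; `≤` for print's `<`; all bonds of `ℤ^d`.
[cite: Balaban1985Averaging, (165) p.43, (56) p.27] -/
def Reg165 (U₀ : Site d → Fin d → 𝔸ˣ) (u : Site d → 𝔸ˣ) (ε : ℝ) : Prop :=
  ∀ (x : Site d) (κ : Fin d), ‖((Rc (U₀ x κ) (u (x + e κ)) : 𝔸ˣ) : 𝔸) - (u x : 𝔸)‖ ≤ ε

/-- **(166)**: "`|(\overline{R₀u^j})(x_j) − 1| < α₃, x_j ∈ Ω^{(j)}, j = 0, 1, …, k`" — the `j`-th order averages (79)–(80)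
`\overline{R₀u}^j` (print's overline spans `R₀u^j`; `B7Eq84Concrete.uavg … j`, a function on the level-`j` lattice `Ω^{(j)}`, here
all of `ℤ^d` in level-`j` coordinates) stay within `α₃` of `1`; `≤` for `<`. [cite: Balaban1985Averaging, (166) p.44, (79)–(80) p.30] -/
def Cond166 (L : ℕ) (U₀ : Site d → Fin d → 𝔸ˣ) (u : Site d → 𝔸ˣ) (k : ℕ) (α₃ : ℝ) : Prop :=
  ∀ j ≤ k, ∀ z : Site d, ‖((uavg L U₀ u j z : 𝔸ˣ) : 𝔸) - 1‖ ≤ α₃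

/-- **(167)**: "`|(\overline{R₀u^j})⁻¹(x_{j+1})(R̄^j_{0,x_{j+1}}\overline{R₀u^j})(x_j) − 1| < α₃L^{j+1}η, x_{j+1} ∈ Ω^{(j+1)},
x_j ∈ B(x_{j+1}), j = 0, 1, …, k − 1`" — `x_{j+1} = z`, `x_j = Lz + r` with `r ∈ [0, L)^d` (the block `B(x_{j+1})`, (78)), and
`(R̄^j_{0,x_{j+1}}w)(x_j) = R(Ū₀^j(Γ_{x_{j+1},x_j}))w(x_j)` the rotation (58) by the transporter of the averaged background `Ū₀^j`
(`avgIter L U₀ j`) along the tree contour `Γ_{x_{j+1},x_j}` (`treeWord`); `η` is a free parameter (print: `η = L^{−k}`);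
`≤` for `<`. [cite: Balaban1985Averaging, (167) p.44, (58) p.27, (78) p.30] -/
def Cond167 (L : ℕ) (U₀ : Site d → Fin d → 𝔸ˣ) (u : Site d → 𝔸ˣ) (k : ℕ) (α₃ η : ℝ) : Prop :=
  ∀ j < k, ∀ (z : Site d) (r : Fin d → Fin L),
    ‖(((uavg L U₀ u j ((L : ℤ) • z))⁻¹
        * Rc (hol (avgIter L U₀ j) ((L : ℤ) • z) (treeWord (boxVec L r)))
            (uavg L U₀ u j ((L : ℤ) • z + boxVec L r)) : 𝔸ˣ) : 𝔸) - 1‖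
      ≤ α₃ * (L : ℝ) ^ (j + 1) * η

/-- **`u ∈ Λ_k(U₀, α₃)`** (p. 44): "`Λ_k(U₀, α₃)` is a set of gauge transformations `u` defined on `Ω`, and satisfying the
conditions (166), (167)". [cite: Balaban1985Averaging, (166)–(167) p.44] -/
def InLambda (L : ℕ) (U₀ : Site d → Fin d → 𝔸ˣ) (u : Site d → 𝔸ˣ) (k : ℕ) (α₃ η : ℝ) : Prop :=
  Cond166 L U₀ u k α₃ ∧ Cond167 L U₀ u k α₃ η

/-- **The averaging step reads the expression of (167)** — p. 44: "More exactly, we have to calculate a logarithm of the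
expression in (167) and this expression is small." By (79) and (78) (`B7Eq84Concrete.uavg_succ`, `B7Eq99Concrete.val_R0avg`),
`(\overline{R₀u}^{j+1})(x_{j+1}) = (\overline{R₀u}^j)(Lx_{j+1})·exp[Σ_{x_j∈B(x_{j+1})} L^{−d} log{(\overline{R₀u}^j)⁻¹(x_{j+1})(R̄^j_{0,x_{j+1}}\overline{R₀u}^j)(x_j)}]`:
the logarithm is taken of exactly the quantity bounded in (167). [cite: Balaban1985Averaging, p.44 (paragraph after (167)), (78)–(79) p.30] -/
theorem val_uavg_succ (L : ℕ) (U₀ : Site d → Fin d → 𝔸ˣ) (u : Site d → 𝔸ˣ) (j : ℕ) (z : Site d) :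
    ((uavg L U₀ u (j + 1) z : 𝔸ˣ) : 𝔸) = (uavg L U₀ u j ((L : ℤ) • z) : 𝔸)
      * exp (∑ r : Fin d → Fin L, (((L : ℝ) ^ d)⁻¹) •
          mlog ((((uavg L U₀ u j ((L : ℤ) • z))⁻¹
            * Rc (hol (avgIter L U₀ j) ((L : ℤ) • z) (treeWord (boxVec L r)))
                (uavg L U₀ u j ((L : ℤ) • z + boxVec L r)) : 𝔸ˣ)) : 𝔸)) := by
  rw [uavg_succ]; exact val_R0avg L (avgIter L U₀ j) (uavg L U₀ u j) ((L : ℤ) • z)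

/-- The averages of the identity gauge transformation are the identity: `\overline{R₀1}^j = 1` (every rotated value
`R(Ū₀^j(Γ))1 = 1`, and the average (78) of the constant `1` is `1`). [cite: Balaban1985Averaging, (78)–(79) p.30] -/
@[simp] theorem uavg_one_right (L : ℕ) (U₀ : Site d → Fin d → 𝔸ˣ) : ∀ j : ℕ, uavg L U₀ (1 : Site d → 𝔸ˣ) j = 1
  | 0 => rfl
  | j + 1 => by
    funext z
    rw [uavg_succ, uavg_one_right L U₀ j]
    have h : R0fun (avgIter L U₀ j) ((L : ℤ) • z) (1 : Site d → 𝔸ˣ) = fun _ => 1 := by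
      funext x; simp
    simp only [R0avg]
    rw [h, savg_const]
    rfl

/-- `1 ∈ Λ_k(U₀, α₃)` for every background and every `α₃, η ≥ 0` (sanity of the typed class). [folklore] -/
theorem inLambda_one (L : ℕ) (U₀ : Site d → Fin d → 𝔸ˣ) (k : ℕ) {α₃ η : ℝ} (hα : 0 ≤ α₃) (hη : 0 ≤ η) :
    InLambda L U₀ (1 : Site d → 𝔸ˣ) k α₃ η := by
  refine ⟨fun j _ z => by simpa using hα, fun j _ z r => ?_⟩
  have : (0 : ℝ) ≤ α₃ * (L : ℝ) ^ (j + 1) * η := by positivity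
  simpa using this

omit [NormedAlgebra ℂ 𝔸] [CompleteSpace 𝔸] in
/-- (165) at the flat background `U₀ = 1` is the plain Lipschitz condition `|u(x + e_κ) − u(x)| ≤ ε` (`R(1) = id`).
[cite: Balaban1985Averaging, (165) p.43] -/
theorem reg165_one_left_iff (u : Site d → 𝔸ˣ) (ε : ℝ) :
    Reg165 (1 : Site d → Fin d → 𝔸ˣ) u ε ↔ ∀ (x : Site d) (κ : Fin d), ‖((u (x + e κ) : 𝔸ˣ) : 𝔸) - (u x : 𝔸)‖ ≤ ε := by
  simp [Reg165]

/-- `InLambda` is monotone in `α₃` and `η` (for `α₃ ≥ 0`). [folklore] -/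
theorem InLambda.mono {L : ℕ} {U₀ : Site d → Fin d → 𝔸ˣ} {u : Site d → 𝔸ˣ} {k : ℕ} {α₃ η α₃' η' : ℝ}
    (h : InLambda L U₀ u k α₃ η) (hα : α₃ ≤ α₃') (hη : η ≤ η') (hα0 : 0 ≤ α₃') (hη0 : 0 ≤ η) :
    InLambda L U₀ u k α₃' η' := by
  refine ⟨fun j hj z => (h.1 j hj z).trans hα, fun j hj z r => (h.2 j hj z r).trans ?_⟩
  have hLp : (0 : ℝ) ≤ (L : ℝ) ^ (j + 1) := by positivity
  calc α₃ * (L : ℝ) ^ (j + 1) * η ≤ α₃' * (L : ℝ) ^ (j + 1) * η := by gcongr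
    _ ≤ α₃' * (L : ℝ) ^ (j + 1) * η' := by gcongr

end Defs

/-! ## §2 (167) under the axial gauge conditions (67): a bound on the double averages `U̿₁^j`, by (108) -/

section ViaEq108

variable {𝔸 : Type*} [NormedRing 𝔸] [NormedAlgebra ℂ 𝔸] [CompleteSpace 𝔸]

/-- **(167) "following from (108)"**: for a solution `u` of the axial gauge conditions (67) at the levels `j < k`, the
expression inside (167) IS `(R̄^j_{0,x_{j+1}}U̿^j_1)(Γ_{x_{j+1},x_j})` by (108) (`B7Eq106Concrete.eq108`), so (167) is exactly a
bound on the twisted transports of the double averages `U̿₁^j` along the block tree contours — at any background `U₀`.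
[cite: Balaban1985Averaging, (167) p.44, (108) p.33] -/
theorem cond167_iff_dbavgCovIter (L : ℕ) (U₀ U₁ : Site d → Fin d → 𝔸ˣ) {u : Site d → 𝔸ˣ} {k : ℕ}
    (hax : AxialGauge L U₀ U₁ u k) (α₃ η : ℝ) :
    Cond167 L U₀ u k α₃ η ↔ ∀ j < k, ∀ (z : Site d) (r : Fin d → Fin L),
      ‖((tHol (avgIter L U₀ j) (dbavgCovIter L U₀ U₁ j) ((L : ℤ) • z) (treeWord (boxVec L r)) : 𝔸ˣ) : 𝔸) - 1‖
        ≤ α₃ * (L : ℝ) ^ (j + 1) * η := by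
  unfold Cond167
  refine forall_congr' fun j => forall_congr' fun hj => forall_congr' fun z => forall_congr' fun r => ?_
  rw [eq108 L U₀ U₁ hax hj z r]

/-- The same at the flat background `U₀ = 1`: (167) for a solution of (67) is a bound on the PLAIN transports
`U̿^j(Γ_{x_{j+1},x_j})` of the iterated double averages `U̿^j = dbavgIter … j` (`Ū₀^j = 1`, `R̄^j_0 = id`).
[cite: Balaban1985Averaging, (167) p.44, (108) p.33, (120) p.35] -/
theorem cond167_iff_dbavgIter_one_left (L : ℕ) (U₁ : Site d → Fin d → 𝔸ˣ) {u : Site d → 𝔸ˣ} {k : ℕ}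
    (hax : AxialGauge L 1 U₁ u k) (α₃ η : ℝ) :
    Cond167 L 1 u k α₃ η ↔ ∀ j < k, ∀ (z : Site d) (r : Fin d → Fin L),
      ‖((hol (dbavgIter L U₁ j) ((L : ℤ) • z) (treeWord (boxVec L r)) : 𝔸ˣ) : 𝔸) - 1‖
        ≤ α₃ * (L : ℝ) ^ (j + 1) * η := by
  rw [cond167_iff_dbavgCovIter L 1 U₁ hax]
  simp only [avgIter_one, dbavgCovIter_one_left, tHol_one_left]

/-- `telUp` at `U₀ = 1` is trivial: `Ū₀^i(Γ^{(n)}) = 1`. [cite: Balaban1985Averaging, (107) p.33] -/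
@[simp] theorem telUp_one_left (L : ℕ) (hL : 1 ≤ L) (i n : ℕ) (x : Site d) :
    telUp L hL (1 : Site d → Fin d → 𝔸ˣ) i n x = 1 := by
  simp [telUp]

/-- `lvFr` at `U₀ = 1` is the flat block frame `B7Prop3Flat.vframe` of `U̿^m = dbavgIter … m` at the centre `x_{m+1}`.
[cite: Balaban1985Averaging, (105) p.33, (110) p.34] -/
theorem lvFr_one_left (L : ℕ) (U₁ : Site d → Fin d → 𝔸ˣ) (m : ℕ) (x : Site d) :
    lvFr L (1 : Site d → Fin d → 𝔸ˣ) U₁ m x = vframe L (dbavgIter L U₁ m) ((L : ℤ) • fl L ((fl L)^[m] x)) := by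
  simp [lvFr]

/-- **(107) at `U₀ = 1`**: for a solution of (67) + (81), every intermediate average is the flat descending
product `(\overline{R₀u}^j)(x_j) = ∏_{l=k−1}^{j} [(\overline{U̿^l})(x_{l+1})⁻¹ · U̿^l(Γ_{x_{l+1},x_l})]` (`B7Eq106Concrete.eq107` with
all background rotations `= 1`). [cite: Balaban1985Averaging, (107) p.33] -/
theorem eq107_one_left (L : ℕ) (hL : 1 ≤ L) (U₁ : Site d → Fin d → 𝔸ˣ) {u : Site d → 𝔸ˣ} {k : ℕ}
    (hax : AxialGauge L 1 U₁ u k) (h81 : ∀ z : Site d, uavg L 1 u k z = 1) {j : ℕ} (hj : j ≤ k) (x : Site d) :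
    uavg L 1 u j ((fl L)^[j] x)
      = dprod (fun i => (lvFr L 1 U₁ (j + i) x)⁻¹ * lvDbT L hL 1 U₁ (j + i) x) (k - j) := by
  rw [eq107 L hL 1 U₁ hax h81 hj x]
  exact dprod_congr _ _ (k - j) fun i _ => by rw [telUp_one_left, inv_one, Rc_one_apply]

end ViaEq108

/-! ## §3 A product estimate -/

section DProdNorm

variable {𝔸 : Type*} [NormedRing 𝔸]

/-- **Small factors give a small descending product**: if `|f_i − 1| ≤ e^{δ_i} − 1` for `i < n`, then
`|∏_{i=n−1}^{0} f_i − 1| ≤ e^{Σ_{i<n} δ_i} − 1` (telescoping `|ab − 1| ≤ (1 + |a − 1|)(1 + |b − 1|) − 1`). [folklore] -/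
theorem norm_dprod_sub_one_le (f : ℕ → 𝔸ˣ) (δ : ℕ → ℝ) :
    ∀ n : ℕ, (∀ i < n, ‖((f i : 𝔸ˣ) : 𝔸) - 1‖ ≤ Real.exp (δ i) - 1) →
      ‖((dprod f n : 𝔸ˣ) : 𝔸) - 1‖ ≤ Real.exp (∑ i ∈ range n, δ i) - 1
  | 0, _ => by simp [dprod_zero]
  | n + 1, h => by
    rw [dprod_succ, Units.val_mul, sum_range_succ, Real.exp_add]
    have h1 : 1 + ‖((f n : 𝔸ˣ) : 𝔸) - 1‖ ≤ Real.exp (δ n) := by linarith [h n (Nat.lt_succ_self n)]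
    have h2 : 1 + ‖((dprod f n : 𝔸ˣ) : 𝔸) - 1‖ ≤ Real.exp (∑ i ∈ range n, δ i) := by
      linarith [norm_dprod_sub_one_le f δ n fun i hi => h i (Nat.lt_succ_of_lt hi)]
    have h3 := mul_le_mul h1 h2 (by positivity) (Real.exp_pos _).le
    linarith [B7Prop6Bound.mul_sub_one_norm_le ((f n : 𝔸ˣ) : 𝔸) ((dprod f n : 𝔸ˣ) : 𝔸),
      mul_comm (Real.exp (δ n)) (Real.exp (∑ i ∈ range n, δ i))]

/-- `|w·t − 1| ≤ e^{p+q} − 1` from `1 + |w − 1| ≤ e^p`, `1 + |t − 1| ≤ e^q`. [folklore] -/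
theorem norm_mul_sub_one_le_exp {w t : 𝔸} {p q : ℝ} (hw : 1 + ‖w - 1‖ ≤ Real.exp p) (ht : 1 + ‖t - 1‖ ≤ Real.exp q) :
    ‖w * t - 1‖ ≤ Real.exp (p + q) - 1 := by
  rw [Real.exp_add]
  have h3 := mul_le_mul hw ht (by positivity) (Real.exp_pos _).le
  linarith [B7Prop6Bound.mul_sub_one_norm_le w t]

end DProdNorm

/-! ## §4 Real-variable bookkeeping -/

section RealAux

/-- `e^x − 1 ≤ 2y` for `0 ≤ x ≤ y ≤ 1` (from `|e^x − 1 − x| ≤ x²` on `|x| ≤ 1`). [folklore] -/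
theorem exp_sub_one_le_two_mul_of_le {x y : ℝ} (hx0 : 0 ≤ x) (hxy : x ≤ y) (hy1 : y ≤ 1) :
    Real.exp x - 1 ≤ 2 * y := by
  have h := Real.abs_exp_sub_one_sub_id_le (show |x| ≤ 1 by rw [abs_of_nonneg hx0]; linarith)
  have h2 : x ^ 2 ≤ x := by nlinarith
  linarith [(abs_le.mp h).2]

/-- `Σ_{i<n} L^{j+i+1} ≤ 2L^{j+n}` for `L ≥ 2` (a geometric sum). [folklore] -/
theorem sum_pow_succ_le {L : ℝ} (hL : 2 ≤ L) (j : ℕ) :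
    ∀ n : ℕ, ∑ i ∈ range n, L ^ (j + i + 1) ≤ 2 * L ^ (j + n)
  | 0 => by simp; positivity
  | n + 1 => by
    rw [sum_range_succ]
    have ih := sum_pow_succ_le hL j n
    have hp : (0 : ℝ) ≤ L ^ (j + n) := by positivity
    have h1 : 2 * L ^ (j + n) ≤ L ^ (j + n + 1) := by
      rw [pow_succ]; nlinarith
    rw [show j + (n + 1) = j + n + 1 by ring]
    linarith

end RealAux

/-! ## §5 The flat background: `U₀ = 1`, `U₁ = e^{B}` with `|B| ≤ b` -/

section Flat

variable {𝔸 : Type*} [NormedRing 𝔸] [NormedAlgebra ℂ 𝔸] [CompleteSpace 𝔸]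

/-- The smallness parameter of level `m`: `θ_m := (dL)·2L^m b = 2d·L^{m+1}·b` — (length of a block tree contour) ×
(Prop. 4's bound (131)/(161) `|log U̿^m| ≤ 2L^m b` at `V₀ = 1`). [cite: Balaban1985Averaging, (161) p.42, (131) p.38] -/
def theta (d L : ℕ) (b : ℝ) (m : ℕ) : ℝ := ((d * L : ℕ) : ℝ) * (2 * ((L : ℝ) ^ m * b))

/-- `θ_m = 2d·b·L^{m+1}`. [folklore] -/
theorem theta_eq (d L : ℕ) (b : ℝ) (m : ℕ) : theta d L b m = 2 * d * b * (L : ℝ) ^ (m + 1) := by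
  simp only [theta, Nat.cast_mul, pow_succ]; ring

/-- `0 ≤ θ_m` for `b ≥ 0`. [folklore] -/
theorem theta_nonneg (d L : ℕ) {b : ℝ} (hb : 0 ≤ b) (m : ℕ) : 0 ≤ theta d L b m := by
  unfold theta; positivity

/-- `θ_m` is monotone in the level `m` (`L ≥ 1`, `b ≥ 0`). [folklore] -/
theorem theta_mono (d : ℕ) {L : ℕ} (hL : 1 ≤ L) {b : ℝ} (hb : 0 ≤ b) {m n : ℕ} (h : m ≤ n) :
    theta d L b m ≤ theta d L b n := by
  rw [theta_eq, theta_eq]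
  have hL' : (1 : ℝ) ≤ L := by exact_mod_cast hL
  have := pow_le_pow_right₀ hL' (Nat.succ_le_succ h)
  have h0 : (0 : ℝ) ≤ 2 * d * b := by positivity
  exact mul_le_mul_of_nonneg_left this h0

/-- `θ_m ≤ 2d·L^k·b` for `m < k`, hence `θ_m ≤ 1/64` under `128·d·L^k b ≤ 1`. [folklore] -/
theorem theta_le_of_lt (d : ℕ) {L : ℕ} (hL : 1 ≤ L) {b : ℝ} (hb : 0 ≤ b) {m k : ℕ} (h : m < k)
    (hs : 128 * (d : ℝ) * ((L : ℝ) ^ k * b) ≤ 1) : theta d L b m ≤ 1 / 64 := by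
  have h1 : theta d L b m ≤ 2 * d * b * (L : ℝ) ^ k := by
    have := theta_mono d hL hb (Nat.le_sub_one_of_lt h)
    rw [theta_eq d L b (k - 1), Nat.sub_add_cancel (Nat.one_le_of_lt h)] at this
    exact this
  linarith

variable (L : ℕ) (hL : 2 ≤ L) (B : Site d → Fin d → 𝔸) {b : ℝ} (hb : 0 ≤ b) (hB : ∀ x κ, ‖B x κ‖ ≤ b)
  (k : ℕ) (hk : 8 * C1 d * ((L : ℝ) ^ k * b) ≤ 1)
include hL hb hB hk

/-- The data of Prop. 4 at `V₀ = 1` in the shape `walk_linear`/`frame_estimate` consume: on every level `m ≤ k`,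
`U̿^m = exp(log U̿^m)` bondwise with `|log U̿^m| ≤ 2L^m b` (`B7Prop4Flat.prop4_flat_induction`, (131) = (161)).
[cite: Balaban1985Averaging, (161) p.42, (131) p.38] -/
theorem dbavgIter_exp_data {m : ℕ} (hm : m ≤ k) (y : Site d) (R : ℕ) :
    ∀ x κ, l1 (x - y) ≤ R →
      ((dbavgIter L (expCfg B) m x κ : 𝔸ˣ) : 𝔸) = exp (logIter L B m x κ) ∧
        ‖logIter L B m x κ‖ ≤ 2 * ((L : ℝ) ^ m * b) := by
  obtain ⟨hX, -, hA⟩ := prop4_flat_induction L hL B hb hB k hk m hm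
  intro x κ _
  refine ⟨?_, hA x κ⟩
  rw [hX]; simp [expCfg]

/-- **Transport bound** (level `m ≤ k`): `|U̿^m(Γ_{y,x}) − 1| ≤ e^{θ_m} − 1` for every block tree contour `Γ_{y,x}`,
`x ∈ B(y)` (length `≤ dL`), by the linear walk estimate of Prop. 1's proof (`B7Prop1Explicit.walk_linear`) fed with Prop. 4's
`|log U̿^m| ≤ 2L^m b`. [cite: Balaban1985Averaging, (161) p.42, p.25 (displays before (47))] -/
theorem norm_hol_dbavgIter_sub_one_le {m : ℕ} (hm : m ≤ k) (q : Site d) (r : Fin d → Fin L) :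
    ‖((hol (dbavgIter L (expCfg B) m) q (treeWord (boxVec L r)) : 𝔸ˣ) : 𝔸) - 1‖ ≤ Real.exp (theta d L b m) - 1 := by
  have ha : (0 : ℝ) ≤ 2 * ((L : ℝ) ^ m * b) := by positivity
  have hlen : (treeWord (boxVec L r)).length ≤ d * L := by
    rw [length_treeWord]; exact l1_boxVec_le L r
  obtain ⟨h1, -⟩ := walk_linear (dbavgIter L (expCfg B) m) (logIter L B m) q (d * L) ha
    (dbavgIter_exp_data L hL B hb hB k hk hm q (d * L)) (treeWord (boxVec L r)) q (by simpa [l1] using hlen)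
  refine h1.trans (sub_le_sub_right (Real.exp_le_exp.mpr ?_) 1)
  unfold theta
  exact mul_le_mul_of_nonneg_right (by exact_mod_cast hlen) ha

/-- **Frame bound** (level `m ≤ k`, `θ_m ≤ 1/64`): `|(\overline{U̿^m})(y)^{±1} − 1| ≤ 8θ_m` for the flat block frame (110) of `U̿^m`
(`B7Prop3Flat.frame_estimate`, (111)–(112) quantitatively). [cite: Balaban1985Averaging, (110)–(112) p.34, (161) p.42] -/
theorem norm_vframe_dbavgIter_sub_one_le {m : ℕ} (hm : m ≤ k) (hθ : theta d L b m ≤ 1 / 64) (q : Site d) :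
    ‖((vframe L (dbavgIter L (expCfg B) m) q : 𝔸ˣ) : 𝔸) - 1‖ ≤ 8 * theta d L b m ∧
      ‖(((vframe L (dbavgIter L (expCfg B) m) q)⁻¹ : 𝔸ˣ) : 𝔸) - 1‖ ≤ 8 * theta d L b m := by
  have ha : (0 : ℝ) ≤ 2 * ((L : ℝ) ^ m * b) := by positivity
  have hL1 : 1 ≤ L := by omega
  obtain ⟨-, -, -, h4, -, h6, -⟩ := frame_estimate (dbavgIter L (expCfg B) m) (logIter L B m) q (d * L) ha
    (dbavgIter_exp_data L hL B hb hB k hk hm q (d * L)) L hL1 q (by simp [l1]) (le_refl (theta d L b m))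
    (theta_nonneg d L hb m) hθ
  exact ⟨h4, h6⟩

/-- **Level factor bound** (`m < k`, `128·d·L^k b ≤ 1`): the level-`m` factor of (106)/(107) at `U₀ = 1`,
`(\overline{U̿^m})(x_{m+1})⁻¹·U̿^m(Γ_{x_{m+1},x_m})`, is within `e^{9θ_m} − 1` of `1`. [cite: Balaban1985Averaging, (106)–(107) p.33] -/
theorem norm_levelFactor_sub_one_le (hs : 128 * (d : ℝ) * ((L : ℝ) ^ k * b) ≤ 1) {m : ℕ} (hm : m < k) (x : Site d) :
    ‖((((lvFr L 1 (expCfg B) m x)⁻¹ * lvDbT L (by omega) 1 (expCfg B) m x) : 𝔸ˣ) : 𝔸) - 1‖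
      ≤ Real.exp (9 * theta d L b m) - 1 := by
  have hL1 : 1 ≤ L := by omega
  have hθ := theta_le_of_lt d hL1 hb hm hs
  rw [Units.val_mul, lvFr_one_left, lvDbT_one_left, show 9 * theta d L b m = 8 * theta d L b m + theta d L b m by ring]
  refine norm_mul_sub_one_le_exp ?_ ?_
  · have h := (norm_vframe_dbavgIter_sub_one_le L hL B hb hB k hk hm.le hθ ((L : ℤ) • fl L ((fl L)^[m] x))).2
    linarith [Real.add_one_le_exp (8 * theta d L b m)]
  · linarith [norm_hol_dbavgIter_sub_one_le L hL B hb hB k hk hm.le ((L : ℤ) • fl L ((fl L)^[m] x))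
      (brem L hL1 ((fl L)^[m] x))]

omit hL hb hB hk in
/-- `(fl L)^[j] (L^j·z) = z`: the level-`j` site `z` is reached from the site `L^j z` of the fine lattice. [folklore] -/
theorem iterate_fl_pow_smul (hL1 : 1 ≤ L) : ∀ (j : ℕ) (z : Site d), (fl L)^[j] (((L : ℤ) ^ j) • z) = z
  | 0, z => by simp
  | j + 1, z => by
    rw [Function.iterate_succ_apply, pow_succ, mul_comm, ← smul_smul, fl_smul hL1, iterate_fl_pow_smul hL1 j z]

/-- **(166) at `U₀ = 1`** for the gauge fixing: for any solution `u` of (67) + (81) relative to `U₀ = 1`, `U₁ = e^{B}`,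
`|B| ≤ b` (`L ≥ 2`, `8C₁(d)·L^k b ≤ 1`, `128d·L^k b ≤ 1`): `|(\overline{R₀u}^j)(x_j) − 1| ≤ e^{36d·L^k b} − 1` for all `j ≤ k` and all
level-`j` sites — by (107) (`eq107_one_left`), the level factor bounds and `Σ_{m=j}^{k−1} 9θ_m ≤ 36d·L^k b`.
[cite: Balaban1985Averaging, (166) p.44, (107) p.33, (161) p.42] -/
theorem cond166_flat (hs : 128 * (d : ℝ) * ((L : ℝ) ^ k * b) ≤ 1) {u : Site d → 𝔸ˣ}
    (hax : AxialGauge L 1 (expCfg B) u k) (h81 : ∀ z : Site d, uavg L 1 u k z = 1) :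
    Cond166 L 1 u k (Real.exp (36 * d * ((L : ℝ) ^ k * b)) - 1) := by
  intro j hj z
  have hL1 : 1 ≤ L := by omega
  rw [← iterate_fl_pow_smul L hL1 j z, eq107_one_left L hL1 (expCfg B) hax h81 hj]
  refine (norm_dprod_sub_one_le _ (fun i => 9 * theta d L b (j + i)) (k - j) fun i hi =>
    norm_levelFactor_sub_one_le L hL B hb hB k hk hs (by omega) _).trans ?_
  refine sub_le_sub_right (Real.exp_le_exp.mpr ?_) 1
  have hL2 : (2 : ℝ) ≤ L := by exact_mod_cast hL
  calc ∑ i ∈ range (k - j), 9 * theta d L b (j + i)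
      = 18 * d * b * ∑ i ∈ range (k - j), (L : ℝ) ^ (j + i + 1) := by
        rw [mul_sum]; exact sum_congr rfl fun i _ => by rw [theta_eq]; ring
    _ ≤ 18 * d * b * (2 * (L : ℝ) ^ (j + (k - j))) :=
        mul_le_mul_of_nonneg_left (sum_pow_succ_le hL2 j (k - j)) (by positivity)
    _ = 36 * d * ((L : ℝ) ^ k * b) := by rw [Nat.add_sub_cancel' hj]; ring

/-- **(167) at `U₀ = 1`** for the gauge fixing: for any solution `u` of (67) relative to `U₀ = 1`, `U₁ = e^{B}`, `|B| ≤ b`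
(`L ≥ 2`, `8C₁(d)·L^k b ≤ 1`): the expression of (167) is `U̿^j(Γ_{x_{j+1},x_j})` by (108) and
`|U̿^j(Γ_{x_{j+1},x_j}) − 1| ≤ e^{θ_j} − 1`, `θ_j = 2d·L^{j+1} b` — the factor `L^{j+1}` of (167) is the growth (161) `|log U̿^j| ≤ 2L^j b`
times the contour length `≤ dL`. [cite: Balaban1985Averaging, (167) p.44, (108) p.33, (161) p.42] -/
theorem cond167_flat {u : Site d → 𝔸ˣ} (hax : AxialGauge L 1 (expCfg B) u k) :
    ∀ j < k, ∀ (z : Site d) (r : Fin d → Fin L),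
      ‖(((uavg L 1 u j ((L : ℤ) • z))⁻¹
          * Rc (hol (avgIter L 1 j) ((L : ℤ) • z) (treeWord (boxVec L r)))
              (uavg L 1 u j ((L : ℤ) • z + boxVec L r)) : 𝔸ˣ) : 𝔸) - 1‖
        ≤ Real.exp (theta d L b j) - 1 := by
  intro j hj z r
  rw [eq108 L 1 (expCfg B) hax hj z r, avgIter_one, dbavgCovIter_one_left, tHol_one_left]
  exact norm_hol_dbavgIter_sub_one_le L hL B hb hB k hk hj.le _ r

/-- **The gauge fixing lies in `Λ_k(1, α₃)`** — p. 43: the functions `u` "given by the formulas (104)–(106) … satisfy other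
conditions following from (107), (108) if the configuration `U₁` is small", made quantitative at the flat background:
for `U₀ = 1`, `U₁ = e^{B}` with `|B| ≤ b`, `L ≥ 2`, `8C₁(d)·L^k b ≤ 1` and `128d·L^k b ≤ 1`, EVERY solution `u` of (67) + (81) —
in particular the gauge fixing (104)–(106) — satisfies (166)–(167) with `α₃ = 72d·L^k b` and `η = L^{−k}`:
`u ∈ Λ_k(1, 72d·L^k b)`. [cite: Balaban1985Averaging, p.43 (Sect. F, paragraph after (165)), (166)–(167) p.44] -/
theorem inLambda_flat (hs : 128 * (d : ℝ) * ((L : ℝ) ^ k * b) ≤ 1) {u : Site d → 𝔸ˣ}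
    (hax : AxialGauge L 1 (expCfg B) u k) (h81 : ∀ z : Site d, uavg L 1 u k z = 1) :
    InLambda L 1 u k (72 * d * ((L : ℝ) ^ k * b)) (((L : ℝ) ^ k)⁻¹) := by
  have hL1 : 1 ≤ L := by omega
  have hLk : (0 : ℝ) < (L : ℝ) ^ k := by positivity
  have ht0 : (0 : ℝ) ≤ d * ((L : ℝ) ^ k * b) := by positivity
  refine ⟨fun j hj z => (cond166_flat L hL B hb hB k hk hs hax h81 j hj z).trans ?_, fun j hj z r =>
    (cond167_flat L hL B hb hB k hk hax j hj z r).trans ?_⟩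
  · have := exp_sub_one_le_two_mul_of_le (x := 36 * d * ((L : ℝ) ^ k * b)) (by positivity) le_rfl (by linarith)
    linarith
  · have hθ1 : theta d L b j ≤ 1 := by linarith [theta_le_of_lt d hL1 hb hj hs]
    refine (exp_sub_one_le_two_mul_of_le (theta_nonneg d L hb j) le_rfl hθ1).trans ?_
    rw [theta_eq, show 72 * (d : ℝ) * ((L : ℝ) ^ k * b) * (L : ℝ) ^ (j + 1) * ((L : ℝ) ^ k)⁻¹
      = 72 * d * b * (L : ℝ) ^ (j + 1) * ((L : ℝ) ^ k * ((L : ℝ) ^ k)⁻¹) by ring, mul_inv_cancel₀ hLk.ne', mul_one]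
    have : (0 : ℝ) ≤ d * b * (L : ℝ) ^ (j + 1) := by positivity
    linarith

omit hb hB hk in
/-- **In print's letters** (`η = L^{−k}`, `|U₁ − 1| < α₁η` read as `U₁ = e^{B}`, `|B| ≤ α₁η`): if `L^kη = 1`, `8C₁(d)α₁ ≤ 1` and
`128d·α₁ ≤ 1`, every solution of (67) + (81) at `U₀ = 1` lies in `Λ_k(1, α₃)` with the EXPLICIT `α₃ = 72d·α₁` — print's
"if the configuration `U₁` is small, i.e., `|U₁ − 1| < α₁η`, `α₁` small" with the `O(1)` made a number.
[cite: Balaban1985Averaging, p.43 (Sect. F, paragraph after (165)), (166)–(167) p.44] -/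
theorem inLambda_flat_eta {η α₁ : ℝ} (hη : (L : ℝ) ^ k * η = 1) (hα : 0 ≤ α₁) (hBη : ∀ x κ, ‖B x κ‖ ≤ η * α₁)
    (h1 : 8 * C1 d * α₁ ≤ 1) (h2 : 128 * (d : ℝ) * α₁ ≤ 1) {u : Site d → 𝔸ˣ}
    (hax : AxialGauge L 1 (expCfg B) u k) (h81 : ∀ z : Site d, uavg L 1 u k z = 1) :
    InLambda L 1 u k (72 * d * α₁) η := by
  have hLk : (0 : ℝ) < (L : ℝ) ^ k := by positivity
  have hη' : η = ((L : ℝ) ^ k)⁻¹ := (inv_eq_of_mul_eq_one_right hη).symm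
  have hηpos : 0 < η := by rw [hη']; positivity
  have hb' : 0 ≤ η * α₁ := by positivity
  have hkey : (L : ℝ) ^ k * (η * α₁) = α₁ := by rw [← mul_assoc, hη, one_mul]
  have := inLambda_flat L hL B hb' hBη k (by rw [hkey]; exact h1) (by rw [hkey]; exact h2) hax h81
  rw [hkey, ← hη'] at this
  exact this

/-- **The constructed gauge fixing** `u = glev … k 0` of `B7Eq84Concrete` (the unique solution of (67) + (81), formulas
(104)–(106)) at `U₀ = 1`, `U₁ = e^{B}`: `u ∈ Λ_k(1, 72d·L^k b)` (with `η = L^{−k}`).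
[cite: Balaban1985Averaging, p.43 (Sect. F, paragraph after (165)), (104)–(106) p.33, (166)–(167) p.44] -/
theorem inLambda_glev_flat (hs : 128 * (d : ℝ) * ((L : ℝ) ^ k * b) ≤ 1) :
    InLambda L 1 (glev L (by omega) 1 (expCfg B) k 0) k (72 * d * ((L : ℝ) ^ k * b)) (((L : ℝ) ^ k)⁻¹) :=
  inLambda_flat L hL B hb hB k hk hs (axialGauge_glev L _ 1 (expCfg B) k) (eq81_glev L _ 1 (expCfg B) k)

end Flat

end Literature.MathematicalPhysics.QuantumFieldTheory.Balaban1983to89.B7Eq167Flat
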